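import Literature.Probability.RandomPlanarGeometry.VertexShellTraversals
import Mathlib.Analysis.SpecialFunctions.Pow.Real
import Mathlib.Data.Fintype.Card
import HarnessLib

/-!
# The discrete short-distance cutoff for lists without repetitions; rate-free sub-shell parameters

Two pieces of elementary bookkeeping for Aizenman–Burchard-type shell-traversal estimates of lattice
paths with a short-distance cutoff (M. Aizenman, A. Burchard, Duke Math. J. 99 (1999) §1.a–b and §3.a;
folklore), continuing `VertexShellTraversals.lean` and `ShellSubdivision.lean`:

* `card_le_of_vertexTraversals_nodup` — the DISCRETE SHORT-DISTANCE CUTOFF: a list WITHOUT REPETITIONS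
  (the vertex sequence of a self-avoiding path) whose image has `2k` weak vertex traversals of a genuine
  shell `D(x; r, R)` has `k` distinct entries mapped into the inner ball `B̄(x, r)`; so if at most `m`
  entries can lie there, the shell is not traversed `2(m+1)` times (AB99 §1.a, "systems with
  short-distance cutoff": below the lattice scale traversal counts are deterministically bounded);
* `tight_subshell_parameters` — the lattice parameters of a sub-shell of aspect `1/u ≥ 32` at mesh
  `δ ≤ s` (virgin radius `N := s/(uδ) - 3`, inner radius `8uN`, event radii `s/δ + 2` and `N - 1`)
  satisfy the side conditions of the virginization lemmas, with the inner radius a MESH-FREE fraction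
  `8u` of `N` (companion of `subshell_parameters` of `ShellSubdivision.lean`, whose inner radius
  `max (s/δ + 3) N₀` is tied to a rate).

No definitions.
-/

noncomputable section

namespace Literature.Probability.RandomPlanarGeometry

/-- **Discrete short-distance cutoff.** If a list `l` without repetitions has, on its image under `f`,
`2k` weak vertex traversals of a genuine shell `D(x; r, R)` (`r < R`), and every entry of `l` mapped into
`B̄(x, r)` belongs to the finset `F`, then `k ≤ #F`: every other traversal is separated
(`sepVertexTraversals_of_two_mul`), the near index of each separated traversal is strictly increasing,
and distinct indices of `l` carry distinct entries. For the vertex sequence of a self-avoiding walk: a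
shell whose inner ball holds `m` cells is not traversed `2(m+1)` times.
[cite: AizenmanBurchard1999, §1.a (short-distance cutoff)] -/
theorem card_le_of_vertexTraversals_nodup {V E : Type*} [PseudoMetricSpace E] {l : List V}
    {f : V → E} {k : ℕ} {x : E} {r R : ℝ} (F : Finset V) (hl : l.Nodup) (hrR : r < R)
    (hF : ∀ v ∈ l, dist (f v) x ≤ r → v ∈ F)
    (h : ∃ ι κ : Fin (2 * k) → Fin (l.map f).length, (∀ m, ι m ≤ κ m) ∧
      (∀ m, (dist ((l.map f).get (ι m)) x ≤ r ∧ R ≤ dist ((l.map f).get (κ m)) x) ∨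
        (R ≤ dist ((l.map f).get (ι m)) x ∧ dist ((l.map f).get (κ m)) x ≤ r)) ∧
      ∀ ⦃m m'⦄, m < m' → κ m ≤ ι m') :
    k ≤ F.card := by
  classical
  obtain ⟨ι, κ, h1, h2, h3⟩ := sepVertexTraversals_of_two_mul h hrR
  have hlen : (l.map f).length = l.length := List.length_map _
  have hget : ∀ i : Fin (l.map f).length, (l.map f).get i = f (l.get (i.cast hlen)) := fun i => by
    simp [List.get_eq_getElem]
  -- the near index of each separated traversal, strictly increasing
  obtain ⟨near, hnear⟩ : ∃ near : Fin k → Fin (l.map f).length, ∀ m, near m =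
      if dist ((l.map f).get (ι m)) x ≤ r then ι m else κ m := ⟨_, fun _ => rfl⟩
  have hnear_le : ∀ m, dist ((l.map f).get (near m)) x ≤ r := fun m => by
    rw [hnear]
    split_ifs with hm
    · exact hm
    · rcases h2 m with h' | h'
      · exact absurd h'.1 hm
      · exact h'.2
  have hιn : ∀ m, ι m ≤ near m := fun m => by
    rw [hnear]; split_ifs; exacts [le_rfl, h1 m]
  have hnκ : ∀ m, near m ≤ κ m := fun m => by
    rw [hnear]; split_ifs; exacts [h1 m, le_rfl]
  have hmono : StrictMono near := fun m m' hmm' =>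
    (hnκ m).trans_lt ((h3 hmm').trans_le (hιn m'))
  -- the near entries are distinct members of `F`
  obtain ⟨g, hg⟩ : ∃ g : Fin k → V, ∀ m, g m = l.get ((near m).cast hlen) := ⟨_, fun _ => rfl⟩
  have hginj : Function.Injective g := fun m m' hmm' => by
    rw [hg, hg] at hmm'
    exact hmono.injective (Fin.cast_injective _ ((List.nodup_iff_injective_get.1 hl) hmm'))
  have hgF : ∀ m, g m ∈ F := fun m =>
    hF _ (hg m ▸ List.get_mem _ _) (by rw [hg, ← hget]; exact hnear_le m)
  calc k = (Finset.univ.image g).card := by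
        rw [Finset.card_image_of_injective _ hginj, Finset.card_univ, Fintype.card_fin]
    _ ≤ F.card := Finset.card_le_card fun v hv => by
        obtain ⟨m, -, rfl⟩ := Finset.mem_image.1 hv
        exact hgF m

/-- **The lattice parameters of a sub-shell, rate-free version.** With mesh `δ ≤ s` (inner radius)
and aspect `1/u ≥ 32`, set (in lattice units) `N := s/(uδ) - 3` (virgin radius), inner radius
`n := 8uN` (`= N/A` for the mesh-free aspect `A := 1/(8u) ≥ 4`), event radii `r := s/δ + 2` and
`R := N - 1`. Then `0 < N`, `r + 1 < R`, `r + 1 ≤ n`, `N/2 + 1 ≤ R` and `n ≤ N`. [folklore] -/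
theorem tight_subshell_parameters {δ s u : ℝ} (hδ : 0 < δ) (hδs : δ ≤ s) (hu : 0 < u)
    (h32 : 32 ≤ 1 / u) :
    0 < s / u / δ - 3 ∧ s / δ + 2 + 1 < s / u / δ - 3 - 1 ∧
    s / δ + 2 + 1 ≤ 8 * u * (s / u / δ - 3) ∧ (s / u / δ - 3) / 2 + 1 ≤ s / u / δ - 3 - 1 ∧
    8 * u * (s / u / δ - 3) ≤ s / u / δ - 3 := by
  -- `p := s/δ ≥ 1`, `w := 1/u ≥ 32`, `s/(uδ) = p w`
  set p := s / δ with hp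
  have hp1 : 1 ≤ p := by rw [hp, le_div_iff₀ hδ]; linarith
  set w := 1 / u with hw
  have hq : s / u / δ = p * w := by rw [hp, hw]; field_simp
  have hu' : u = 1 / w := by rw [hw, one_div_one_div]
  have hwpos : 0 < w := by rw [hw]; positivity
  have hpw : 32 * p ≤ p * w := by nlinarith
  have e : 8 * (1 / w) * (p * w - 3) = 8 * p - 24 / w := by field_simp; ring
  have h24 : 24 / w ≤ 24 / 32 := div_le_div_of_nonneg_left (by norm_num) (by norm_num) h32
  have h24' : 0 ≤ 24 / w := by positivity
  rw [hq, hu', e]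
  refine ⟨by nlinarith, by nlinarith, by nlinarith, by nlinarith, by nlinarith⟩

end Literature.Probability.RandomPlanarGeometry

end
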